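import Literature.NumberTheory.DiophantineGeometry.BcgpSwitchExistsModularAbelianSurface
import Literature.NumberTheory.GaloisRepresentations.CrystallineOrdinaryShape
import Literature.NumberTheory.DiophantineGeometry.AVGaloisModule
import Literature.AlgebraicGeometry.Motives.AbelianVariety
import HarnessLib

/-!
# BCGP 2025, Lemma 10.4.1 along its printed proof: residual modularity at the surjective
`GSp₄(𝔽_p)` residues of type-**A** surfaces ⟹ modularity of the surfaces with `End_ℚ(A) = ℤ`

Topic `NumberTheory/DiophantineGeometry`, next to
`bcgp_serreRegularWeight_implies_allAbelianSurfacesModular` (the same printed lemma typed for route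
`Langlands/RegularSerreAbelianSurfaces`) and `bcgp_switch_exists_modular_abelianSurface`. One named
fact — a published IMPLICATION whose three brackets are written inline (a `Literature` file may not
import a `Theses` file, nor give an unproved hypothesis a `def` of its own); neither hypothesis is
asserted. No `sorry`, no new mathematical object. Requested by cite item wi-37458 for route
`Langlands/AbelianSurfaceSerre`, whose support item `BCGPSerreReduction :
SerreGSp4Surjective → QuadraticImprimitiveSurfaces → EndTrivialSurfacesModular` it closes by
`exact h` (the three brackets below are VERBATIM the bodies of those three route definitions).

Source: G. Boxer, F. Calegari, T. Gee, V. Pilloni, *Modularity theorems for abelian surfaces*,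
arXiv:2502.20645 [BoxerCalegariGeePilloni2025]: §10.4 **Lemma 10.4.1** with **Remark 10.4.2** and
its PROOF (p. 146); §10.2 **Theorem 10.2.1**, **Remark 10.2.2**; §1.8.12 **Definition 1.8.12**.

PRINTED STATEMENTS (quoted from the source).

* Lemma 10.4.1. *Suppose that for every residual representation `ρ̄ : G_ℚ → GSp₄(𝔽_p)` satisfying
  the following conditions: `ρ̄` has multiplier `ε̄⁻¹`; `ρ̄` is absolutely irreducible; the
  semi-simplification of `ρ̄|_{G_{ℚ_p}}` is a direct sum of characters, there exists an ordinary
  cuspidal automorphic representation `π` of `GSp₄/ℚ` of regular weight, level prime to `p`, and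
  central character `|·|²`, such that `ρ̄_{π,p} ≅ ρ̄`. Then all abelian surfaces `A/ℚ` are
  modular.* Remark 10.4.2: *"one could only demand the statement for `p` sufficiently large."*
* Its proof (p. 146): *"By Theorem 10.2.1, we may assume that `A` is 'challenging', i.e. that
  either `End(A_ℚ̄) = ℤ`, or that `A` has Galois type **B**[C₂] … By [BCGP 2021], there is a density
  one set of primes `p > 2` such that `A` is ordinary at `p` and residually `p`-distinguished, and
  moreover that `ρ̄ = ρ̄_{A,p}` satisfies the hypotheses listed in the statement of this lemma, as
  well as being vast … and tidy … We now deduce the modularity of `A` as a consequence of Theorem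
  ('`ρ` is modular from multiplicity one and classicity') for `ρ = ρ_{A,p}` … Finally if
  `End(A_ℚ̄) = ℤ`, then for sufficiently large `p` we have `ρ̄_{A,p}(G_ℚ) = GSp₄(𝔽_p)`."* So the
  hypothesis is invoked ONLY at `ρ̄ = ρ̄_{A,p}` for one suitable large `p`, and for type **A** that
  residual representation has image all of `GSp₄(𝔽_p)` ([BoxerEtAl2021, §9.2], proof of the lemma
  "challenging ⟹ `ρ̄_{A,l}` vast and tidy for a density-one set of `l`", from Serre's open-image
  theorem) and is residually `p`-distinguished weight-2 ordinary at `p` ([BoxerEtAl2021, §9.2],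
  Definition "good prime" and the lemma "good primes have relative density one").
* Theorem 10.2.1 (p. 138). *Let `A/ℚ` be an abelian surface. Suppose that the Galois type of `A` is
  neither **A** nor **B**[C₂]. Then `A` is modular.* (proved there unconditionally, p. 139); p. 138:
  *"the Galois type of `A/ℚ` is **A** precisely when `End(A_ℚ̄) = ℤ`, and `A/ℚ` has type **B**[C₂]
  if there exists a quadratic field `K/ℚ` so that `End(A) = ℤ` but `End(A_K) ⊗ ℚ` is either
  `ℚ ⊕ ℚ` or a real quadratic field"*; Remark 10.2.2: for such `A/K` of `GL₂`-type *"the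
  modularity of such abelian surfaces remains open in general even for real quadratic fields `K`"*.
* Definition 1.8.12. *`A/F` is modular if there exist C-algebraic cuspidal automorphic
  representations `π_i` for `GL_{n_i}/F` with `4 = Σ n_i` such that
  `L(s, H¹(A)) = ∏ L(s, π_i ⊗ |det|^{(1-n_i)/2})`.*

TYPED FORM — how the three brackets relate to the printed text (the points a reviewer or refuter
should attack).

* FIRST BRACKET (hypothesis K1 = route def `SerreGSp4Surjective`): the printed hypothesis of
  Lemma 10.4.1 RESTRICTED to `p ≥ p₀` (Remark 10.4.2) and to those `ρ̄ : Γ_ℚ → GL₄(𝔽_p)` that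
  preserve a non-degenerate alternating `J` up to the multiplier `ε̄_p⁻¹`
  (`modPCyclotomicCharacterZMod`), have image ALL of `GSp(J)(𝔽_p)` (in particular absolutely
  irreducible) and are upper-triangularisable over `𝔽̄_p` on `Γ_{ℚ_p}` with pairwise distinct
  diagonal characters ("semisimplification a sum of characters" + residually `p`-distinguished) —
  by the proof quoted above these are exactly the residual representations at which the printed
  proof invokes the hypothesis in the case `End(A_ℚ̄) = ℤ`. Its conclusion is written through the
  `GL₄` proxy (the tree has no automorphic representations of `GSp₄`): a REGULAR ALGEBRAIC cuspidal
  `π` on `GL₄(𝔸_ℚ)` unramified at `p`, `ι : ℚ̄_p ≃ ℂ` and a framed `r` Satake–Frobenius compatible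
  with `(π, ι)` almost everywhere (`arithFrobPolyOfSatake ι q_v 4`, Harris–Lan–Taylor–Thorne
  normalisation), of symplectic type, crystalline-ordinary of strictly increasing shape at `p`,
  with integral characteristic polynomials reducing to those of `ρ̄ ⊗ 𝔽̄_p`. To recover the PRINTED
  `π` on `GSp₄` from this one composes with the same descent package as for
  `bcgp_serreRegularWeight_implies_allAbelianSurfacesModular`: `π ≅ π^∨ ⊗ χ` of symplectic type
  (from `r` symplectic with absolutely irreducible reduction, Chebotarev, strong multiplicity one),
  DESCENT `GL₄ → GSp₄` [cite: Arthur2013] [cite: GeeTaibi2019, §2] (resting on the twisted weighted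
  fundamental lemma, BCGP §1.6), regular weight from regular algebraicity, level prime to `p` from
  unramifiedness at `p`, ordinarity of `π_p` from `r` crystalline-ordinary of regular shape
  (crystalline local–global compatibility at `p`), `ρ̄_{π,p} ≅ ρ̄` from the congruence of
  characteristic polynomials and Brauer–Nesbitt (ρ̄ absolutely irreducible).
* SECOND BRACKET (hypothesis K2 = route def `QuadraticImprimitiveSurfaces`): modularity, in the
  sense of the third bracket, of every `A/ℚ` with `End_ℚ(A) = ℤ` whose `ℓ`-adic `r` becomes
  reducible over some quadratic field — ASSUMED outright (a hypothesis, so a weakening of the typed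
  implication); it contains Galois type **B**[C₂] (p. 138: `End(A) = ℤ`, `End(A_K) ⊗ ℚ = ℚ ⊕ ℚ` or
  real quadratic, so `r|_{Γ_K}` is reducible), the second "challenging" type, for which the
  printed proof would use the hypothesis at residues of image `SL₂(𝔽_p) ≀ ℤ/2` instead.
* THIRD BRACKET (conclusion = route def `EndTrivialSurfacesModular`): for every abelian surface
  `A/ℚ` (`AbelianVariety ℚ`, `dim = 2`) with `End_ℚ(A) = ℤ`, every prime `p`, `ℚ_p`-basis `b` of
  `V_p A`, the framed `r` of `Γ_ℚ` on `H¹_ét(A_ℚ̄, ℚ̄_p) = (V_p A)^∨ ⊗ ℚ̄_p` in the dual basis (frame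
  clause verbatim from `bcgp_switch_exists_modular_abelianSurface`), every level witness and
  `ι : ℚ̄_p ≃ ℂ`, an L-algebraic cuspidal `π` on `GL₄(𝔸_ℚ)` whose Satake parameters give the
  arithmetic-Frobenius characteristic polynomials of `r` at almost all places. This is
  Definition 1.8.12 in the one-factor case `n₁ = 4` — the case forced here: `End_ℚ(A) = ℤ` makes
  `V_p A` absolutely irreducible [cite: Faltings1983Endlichkeit, Satz 4 and Korollar 1]
  (`End_{Γ_ℚ}(V_p A) = End_ℚ(A) ⊗ ℚ_p = ℚ_p`, `V_p A` semisimple), so no isobaric sum can match.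
* WHICH PRINTED RESULT COVERS WHICH SURFACE of the third bracket: type **A** — the proof of
  Lemma 10.4.1 quoted above with the first bracket; quadratically imprimitive (⊇ type **B**[C₂] and
  **E**[D_n]) — the second bracket; every other Galois type — Theorem 10.2.1, unconditionally.

So the typed implication is [proof of Lemma 10.4.1, case **A**, with Remark 10.4.2] ∘ [descent
`GL₄ → GSp₄` and ordinarity at `p`] + [Theorem 10.2.1] + [Faltings]; each a proved, published
result; the two hypotheses are the open inputs and are not asserted here. Consumers take
`(h : bcgp_serreSurjective_quadraticImprimitive_implies_endTrivialSurfacesModular)`.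

## References

* [BoxerCalegariGeePilloni2025] G. Boxer, F. Calegari, T. Gee, V. Pilloni, *Modularity theorems
  for abelian surfaces*, arXiv:2502.20645: Lemma 10.4.1, Remark 10.4.2 and proof p. 146;
  Theorem 10.2.1, Remark 10.2.2 (p. 138–139); Definition 1.8.12; §1.8.10 (transfer `GSp₄ ↔ GL₄`).
* [BoxerEtAl2021] G. Boxer, F. Calegari, T. Gee, V. Pilloni, *Abelian surfaces over totally real
  fields are potentially modular*, Publ. Math. IHÉS 134 (2021), §9.2 (challenging surfaces: big
  image, good primes of density one).
* [Faltings1983Endlichkeit] G. Faltings, *Endlichkeitssätze für abelsche Varietäten über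
  Zahlkörpern*, Invent. Math. 73 (1983), Satz 4, Korollar 1 (Tate conjecture, semisimplicity).
* [Arthur2013] J. Arthur, *The endoscopic classification of representations*, AMS Colloq. Publ. 61.
* [GeeTaibi2019] T. Gee, O. Taïbi, *Arthur's multiplicity formula for GSp₄ and restriction to
  Sp₄*, J. Éc. polytech. Math. 6 (2019), §2.
* T. Gee, ICM 2026 survey, arXiv:2510.02756, §6 ("an appropriate version of Serre's conjecture for
  GSp₄ … analogous to Khare's theorem").
-/

namespace Literature.NumberTheory.DiophantineGeometry

/-- **BCGP 2025 Lemma 10.4.1 along its printed proof (with Remark 10.4.2), Theorem 10.2.1 and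
Faltings — typed form for route `AbelianSurfaceSerre`.** IF (first bracket) for all large `p` every
`ρ̄ : Γ_ℚ → GL₄(𝔽_p)` of symplectic similitude type with multiplier `ε̄_p⁻¹`, image all of
`GSp₄(𝔽_p)` and residually `p`-distinguished triangularisable at `p` is congruent to the
crystalline-ordinary symplectic `r = r_{π,ι}` of a regular algebraic cuspidal `π` on `GL₄(𝔸_ℚ)`
unramified at `p` (the residual-modularity hypothesis of Lemma 10.4.1 at exactly the residues its
proof uses for `End(A_ℚ̄) = ℤ`, read through the `GL₄` proxy), AND (second bracket) every abelian
surface `A/ℚ` with `End_ℚ(A) = ℤ` whose `p`-adic representation becomes reducible over a quadratic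
field is modular, THEN (third bracket) every abelian surface `A/ℚ` with `End_ℚ(A) = ℤ` is modular:
an L-algebraic cuspidal `π` on `GL₄(𝔸_ℚ)` with cofinite Satake–Frobenius matching with
`H¹_ét(A_ℚ̄, ℚ̄_p)` (Definition 1.8.12, one factor). The implication is what the source proves
(type **A**: proof of Lemma 10.4.1, p. 146; the other Galois types outside the second bracket:
Theorem 10.2.1), composed with the descent `GL₄ → GSp₄` and Faltings' isogeny theorem — see the
module docstring; its hypotheses are not asserted here. Users take
`(h : bcgp_serreSurjective_quadraticImprimitive_implies_endTrivialSurfacesModular)`.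
[cite: BoxerCalegariGeePilloni2025, Lemma 10.4.1, Rem. 10.4.2, proof p. 146; Thm 10.2.1; Def. 1.8.12]
[cite: BoxerEtAl2021, §9.2 (big image and good primes of density one for challenging surfaces)]
[cite: Faltings1983Endlichkeit, Satz 4, Korollar 1]
[cite: Arthur2013, Thm 1.5.2 (descent GL₄ → GSp₄ used to read the GL₄ proxy)]
[cite: GeeTaibi2019, §2 (Arthur's classification for GSp₄)] -/
def bcgp_serreSurjective_quadraticImprimitive_implies_endTrivialSurfacesModular : Prop :=
    (∃ p₀ : ℕ, ∀ (p : ℕ) [Fact p.Prime], p₀ ≤ p → ∀ ρ :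
    Literature.NumberTheory.GaloisRepresentations.FramedGaloisRep ℚ (ZMod p) 4, (∃ J : Matrix (Fin
    4) (Fin 4) (ZMod p), J.transpose = -J ∧ IsUnit J.det ∧ (∀ g : Field.absoluteGaloisGroup ℚ, (ρ
    g).val.transpose * J * (ρ g).val =
    (((Literature.NumberTheory.GaloisRepresentations.modPCyclotomicCharacterZMod ℚ p g)⁻¹ : (ZMod
    p)ˣ) : ZMod p) • J) ∧ ∀ M : GL (Fin 4) (ZMod p), (∃ c : ZMod p, IsUnit c ∧ M.val.transpose * J *
    M.val = c • J) → M ∈ ρ.toMonoidHom.range) → (∀ v : IsDedekindDomain.HeightOneSpectrum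
    (NumberField.RingOfIntegers ℚ), ((p : ℕ) : NumberField.RingOfIntegers ℚ) ∈ v.asIdeal → ∃ g : GL
    (Fin 4) (AlgebraicClosure (ZMod p)), (∀ (τ : Field.absoluteGaloisGroup (v.adicCompletion ℚ)) (i
    j : Fin 4), j < i → (g.val * ((ρ.toLocal v τ).val.map (algebraMap (ZMod p) (AlgebraicClosure
    (ZMod p)))) * (g⁻¹).val) i j = 0) ∧ ∀ i j : Fin 4, i ≠ j → ∃ τ : Field.absoluteGaloisGroup
    (v.adicCompletion ℚ), (g.val * ((ρ.toLocal v τ).val.map (algebraMap (ZMod p) (AlgebraicClosure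
    (ZMod p)))) * (g⁻¹).val) i i ≠ (g.val * ((ρ.toLocal v τ).val.map (algebraMap (ZMod p)
    (AlgebraicClosure (ZMod p)))) * (g⁻¹).val) j j) → ∃ (hcpt :
    Literature.NumberTheory.Automorphic.isCompact_glFiniteIntegralLevel 4 ℚ) (π :
    Literature.NumberTheory.Automorphic.CuspidalAutomorphicRepData 4 ℚ hcpt) (ι : PadicAlgCl p ≃+*
    ℂ) (r : Literature.NumberTheory.GaloisRepresentations.FramedGaloisRep ℚ (PadicAlgCl p) 4),
    π.1.IsRegularAlgebraic ∧ (∀ v : IsDedekindDomain.HeightOneSpectrum (NumberField.RingOfIntegers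
    ℚ), ((p : ℕ) : NumberField.RingOfIntegers ℚ) ∈ v.asIdeal → π.1.IsUnramifiedAt v ∧ ∃ a : Fin 4 →
    ℕ, StrictMono a ∧ r.IsCrystallineOrdinaryOfShapeAt v a) ∧ (∀ᶠ v :
    IsDedekindDomain.HeightOneSpectrum (NumberField.RingOfIntegers ℚ) in Filter.cofinite, ∃ a :
    Multiset ℂ, π.1.HasSatakeParamAt v a ∧ r.IsUnramifiedAt v ∧ r.HasFrobCharpolyAt v
    (Literature.NumberTheory.Automorphic.arithFrobPolyOfSatake ι v.residueCard 4 a)) ∧ (∃ ν :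
    Field.absoluteGaloisGroup ℚ → PadicAlgCl p, r.IsSymplecticWithMultiplierFun ν) ∧ ∃ red :
    (Valued.v : Valuation (PadicAlgCl p) NNReal).valuationSubring →+* AlgebraicClosure (ZMod p), ∀ g
    : Field.absoluteGaloisGroup ℚ, ∃ P : Polynomial (Valued.v : Valuation (PadicAlgCl p)
    NNReal).valuationSubring, P.map (Valued.v : Valuation (PadicAlgCl p)
    NNReal).valuationSubring.subtype =
    Literature.NumberTheory.GaloisRepresentations.FramedRep.charpoly r g ∧ P.map red =
    (Literature.NumberTheory.GaloisRepresentations.FramedRep.charpoly ρ g).map (algebraMap (ZMod p)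
    (AlgebraicClosure (ZMod p)))) →
    (∀ (A : Literature.AlgebraicGeometry.Motives.AbelianVariety ℚ), A.dim = 2 → (∀ f : A ⟶ A, ∃ n :
    ℤ, f = n • CategoryTheory.CategoryStruct.id A) → ∀ (p : ℕ) [Fact p.Prime] (b : Module.Basis (Fin
    4) ℚ_[p] (A.rationalTateModule p)) (r :
    Literature.NumberTheory.GaloisRepresentations.FramedGaloisRep ℚ (PadicAlgCl p) 4), (∀ g :
    Field.absoluteGaloisGroup ℚ, (r g).val = ((LinearMap.toMatrix b b (A.rationalTateRep p g⁻¹)).map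
    (algebraMap ℚ_[p] (PadicAlgCl p))).transpose) → (∃ (K : Type) (_ : Field K) (_ : NumberField K),
    Module.finrank ℚ K = 2 ∧ ¬ Literature.NumberTheory.GaloisRepresentations.FramedRep.IsIrreducible
    (r.restrictField K)) → ∀ (hcpt :
    Literature.NumberTheory.Automorphic.isCompact_glFiniteIntegralLevel 4 ℚ) (ι : PadicAlgCl p ≃+*
    ℂ), ∃ π : Literature.NumberTheory.Automorphic.CuspidalAutomorphicRepData 4 ℚ hcpt,
    π.1.IsLAlgebraic ∧ ∀ᶠ v : IsDedekindDomain.HeightOneSpectrum (NumberField.RingOfIntegers ℚ) in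
    Filter.cofinite, ∃ a : Multiset ℂ, π.1.HasSatakeParamAt v a ∧ r.IsUnramifiedAt v ∧
    r.HasFrobCharpolyAt v (Literature.NumberTheory.Automorphic.arithFrobPolyOfSatake ι v.residueCard
    1 a)) →
    ∀ (A : Literature.AlgebraicGeometry.Motives.AbelianVariety ℚ), A.dim = 2 → (∀ f : A ⟶ A, ∃ n :
    ℤ, f = n • CategoryTheory.CategoryStruct.id A) → ∀ (p : ℕ) [Fact p.Prime] (b : Module.Basis (Fin
    4) ℚ_[p] (A.rationalTateModule p)) (r :
    Literature.NumberTheory.GaloisRepresentations.FramedGaloisRep ℚ (PadicAlgCl p) 4), (∀ g :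
    Field.absoluteGaloisGroup ℚ, (r g).val = ((LinearMap.toMatrix b b (A.rationalTateRep p g⁻¹)).map
    (algebraMap ℚ_[p] (PadicAlgCl p))).transpose) → ∀ (hcpt :
    Literature.NumberTheory.Automorphic.isCompact_glFiniteIntegralLevel 4 ℚ) (ι : PadicAlgCl p ≃+*
    ℂ), ∃ π : Literature.NumberTheory.Automorphic.CuspidalAutomorphicRepData 4 ℚ hcpt,
    π.1.IsLAlgebraic ∧ ∀ᶠ v : IsDedekindDomain.HeightOneSpectrum (NumberField.RingOfIntegers ℚ) in
    Filter.cofinite, ∃ a : Multiset ℂ, π.1.HasSatakeParamAt v a ∧ r.IsUnramifiedAt v ∧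
    r.HasFrobCharpolyAt v (Literature.NumberTheory.Automorphic.arithFrobPolyOfSatake ι v.residueCard
    1 a)


end Literature.NumberTheory.DiophantineGeometry
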